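import Summits.AtomisticToContinuum.Crystallization.Theorems.FrustratedLawDichotomyRobustGoodSignature

/-!
# FrustratedLawDichotomy · crux `AperiodicFrustratedLawGap` (stmt-AtomisticToContinuum-27623) — COORDINATION NUMBER TWELVE OF A ROBUSTLY GOOD
# SITE (census instrument, sequel of `FrustratedLawDichotomyRobustGoodSignature`; decomp-a2c, prover hand 2, structural share, generation 7)

For the `#good` term of `FDG` an instrument needs the cheapest certificates of NON-goodness.  Here: a robustly good site `p` of a set `X`
(pattern `Pat` of unit vectors pairwise `≥ 1` apart with twelve elements, data `(d, η, γ, A, t)`, `η ≤ 1/20`) has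

* `shell_injective` : an injective shell map `t` (`dist (t u) (t v) ≥ (1 − 2η)·d > 0`);
* `shell_eq_range` : its punctured `(13/10·d + γ)`-ball `{s ∈ X | s ≠ p, dist s p < 13/10·d + γ}` EQUAL to `range t`;
* `coordination_eq_twelve` : hence exactly twelve atoms of `X` other than `p` within `13/10·d + γ` (and within `13/10·d − γ`) — for the fcc and
  the hcp pattern (`coordination_eq_twelve_fcc`, `coordination_eq_twelve_hcp`).

So a site whose punctured `13/10·nn`-shell does not hold exactly twelve atoms is not robustly good at that scale, by counting.  `[folklore]`.
-/

noncomputable section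

namespace Summit.AtomisticToContinuum.Crystallization.Theorems.FrustratedLawDichotomyRobustGoodCoordination

open Literature.Geometry.DiscreteGeometry
open Summit.AtomisticToContinuum.Crystallization.Theorems.FrustratedLawDichotomyRobustGoodSignature (dist_shell_sub_le)

variable {X : Set (EuclideanSpace ℝ (Fin 3))} {Pat : Finset (EuclideanSpace ℝ (Fin 3))} {p : EuclideanSpace ℝ (Fin 3)} {d η γ : ℝ}
  {A : EuclideanSpace ℝ (Fin 3) →ₗᵢ[ℝ] EuclideanSpace ℝ (Fin 3)} {t : ↥Pat → EuclideanSpace ℝ (Fin 3)}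

/-- **The shell map is injective** (`η ≤ 1/20`, pattern pairwise `≥ 1` apart). [folklore] -/
theorem shell_injective (hPat1 : ∀ u ∈ Pat, ∀ v ∈ Pat, u ≠ v → 1 ≤ dist u v) (hd : 0 < d) (hη : η ≤ 1 / 20)
    (ht : ∀ u : ↥Pat, ‖(t u - p) - d • A (u : EuclideanSpace ℝ (Fin 3))‖ ≤ η * d) : Function.Injective t := by
  intro u v huv
  by_contra hne
  have h1 : 1 ≤ dist (u : EuclideanSpace ℝ (Fin 3)) v := hPat1 u u.2 v v.2 fun h => hne (Subtype.ext h)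
  have h2 := (abs_le.1 (dist_shell_sub_le hd.le ht u v)).1
  rw [huv, dist_self] at h2
  nlinarith

/-- **The punctured `(13/10·d + γ)`-shell is the range of the shell map.** [folklore] -/
theorem shell_eq_range (hPatn : ∀ u ∈ Pat, ‖u‖ = 1) (hd : 0 < d) (hγ : 0 < γ) (hη : η ≤ 1 / 20)
    (ht : ∀ u : ↥Pat, t u ∈ X ∧ ‖(t u - p) - d • A (u : EuclideanSpace ℝ (Fin 3))‖ ≤ η * d)
    (hgap : ∀ s ∈ X, s ≠ p → dist s p < 13 / 10 * d + γ → dist s p ≤ 13 / 10 * d - γ ∧ s ∈ Set.range t) :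
    {s : EuclideanSpace ℝ (Fin 3) | s ∈ X ∧ s ≠ p ∧ dist s p < 13 / 10 * d + γ} = Set.range t := by
  ext s
  constructor
  · rintro ⟨hs, hsp, hlt⟩
    exact (hgap s hs hsp hlt).2
  · rintro ⟨u, rfl⟩
    have hAu : ‖d • A (u : EuclideanSpace ℝ (Fin 3))‖ = d := by
      rw [norm_smul, Real.norm_of_nonneg hd.le, A.norm_map, hPatn u u.2, mul_one]
    have hup : dist (t u) p ≤ d + η * d := by
      rw [dist_eq_norm]
      have := norm_add_le ((t u - p) - d • A (u : EuclideanSpace ℝ (Fin 3))) (d • A (u : EuclideanSpace ℝ (Fin 3)))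
      rw [sub_add_cancel, hAu] at this
      linarith [(ht u).2]
    have hlo : d - η * d ≤ dist (t u) p := by
      rw [dist_eq_norm]
      have := norm_sub_le_norm_add (d • A (u : EuclideanSpace ℝ (Fin 3))) ((t u - p) - d • A (u : EuclideanSpace ℝ (Fin 3)))
      have h' : d • A (u : EuclideanSpace ℝ (Fin 3)) - ((t u - p) - d • A (u : EuclideanSpace ℝ (Fin 3))) =
          -(t u - p) + 2 • (d • A (u : EuclideanSpace ℝ (Fin 3))) := by
        rw [two_smul]; abel
      have h3 := norm_sub_norm_le (d • A (u : EuclideanSpace ℝ (Fin 3))) ((d • A (u : EuclideanSpace ℝ (Fin 3))) - (t u - p))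
      rw [sub_sub_cancel, hAu] at h3
      have h4 : ‖d • A (u : EuclideanSpace ℝ (Fin 3)) - (t u - p)‖ = ‖(t u - p) - d • A (u : EuclideanSpace ℝ (Fin 3))‖ := norm_sub_rev _ _
      rw [h4] at h3
      linarith [(ht u).2]
    have hne : t u ≠ p := by
      intro h
      rw [h, dist_self] at hlo
      nlinarith
    exact ⟨(ht u).1, hne, by nlinarith⟩

/-- **Coordination number twelve**: under the clauses of robust goodness (pattern of twelve unit vectors pairwise `≥ 1` apart, `η ≤ 1/20`),
exactly twelve atoms of `X` other than `p` lie within `13/10·d + γ` of `p` (the nearest-neighbour clause is not needed). [folklore] -/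
theorem coordination_eq_twelve (hcard : Pat.card = 12) (hPatn : ∀ u ∈ Pat, ‖u‖ = 1)
    (hPat1 : ∀ u ∈ Pat, ∀ v ∈ Pat, u ≠ v → 1 ≤ dist u v) (hd : 0 < d) (hγ : 0 < γ) (hη : η ≤ 1 / 20)
    (ht : ∀ u : ↥Pat, t u ∈ X ∧ ‖(t u - p) - d • A (u : EuclideanSpace ℝ (Fin 3))‖ ≤ η * d)
    (hgap : ∀ s ∈ X, s ≠ p → dist s p < 13 / 10 * d + γ → dist s p ≤ 13 / 10 * d - γ ∧ s ∈ Set.range t) :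
    {s : EuclideanSpace ℝ (Fin 3) | s ∈ X ∧ s ≠ p ∧ dist s p < 13 / 10 * d + γ}.ncard = 12 := by
  rw [shell_eq_range hPatn hd hγ hη ht hgap, Set.ncard_range_of_injective (shell_injective hPat1 hd hη fun u => (ht u).2),
    Nat.card_eq_fintype_card, Fintype.card_coe, hcard]

/-- fcc instance. [folklore] -/
theorem coordination_eq_twelve_fcc {t : ↥fccKissingPattern → EuclideanSpace ℝ (Fin 3)} (hd : 0 < d) (hγ : 0 < γ) (hη : η ≤ 1 / 20)
    (ht : ∀ u : ↥fccKissingPattern, t u ∈ X ∧ ‖(t u - p) - d • A (u : EuclideanSpace ℝ (Fin 3))‖ ≤ η * d)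
    (hgap : ∀ s ∈ X, s ≠ p → dist s p < 13 / 10 * d + γ → dist s p ≤ 13 / 10 * d - γ ∧ s ∈ Set.range t) :
    {s : EuclideanSpace ℝ (Fin 3) | s ∈ X ∧ s ≠ p ∧ dist s p < 13 / 10 * d + γ}.ncard = 12 :=
  coordination_eq_twelve card_fccKissingPattern (fun _ hu => norm_eq_one_of_mem_fccKissingPattern hu)
    (fun _ hu _ hv huv => one_le_dist_of_mem_fccKissingPattern hu hv huv) hd hγ hη ht hgap

/-- hcp instance. [folklore] -/
theorem coordination_eq_twelve_hcp {t : ↥hcpKissingPattern → EuclideanSpace ℝ (Fin 3)} (hd : 0 < d) (hγ : 0 < γ) (hη : η ≤ 1 / 20)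
    (ht : ∀ u : ↥hcpKissingPattern, t u ∈ X ∧ ‖(t u - p) - d • A (u : EuclideanSpace ℝ (Fin 3))‖ ≤ η * d)
    (hgap : ∀ s ∈ X, s ≠ p → dist s p < 13 / 10 * d + γ → dist s p ≤ 13 / 10 * d - γ ∧ s ∈ Set.range t) :
    {s : EuclideanSpace ℝ (Fin 3) | s ∈ X ∧ s ≠ p ∧ dist s p < 13 / 10 * d + γ}.ncard = 12 :=
  coordination_eq_twelve card_hcpKissingPattern (fun _ hu => norm_eq_one_of_mem_hcpKissingPattern hu)
    (fun _ hu _ hv huv => one_le_dist_of_mem_hcpKissingPattern hu hv huv) hd hγ hη ht hgap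

end Summit.AtomisticToContinuum.Crystallization.Theorems.FrustratedLawDichotomyRobustGoodCoordination

end
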